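import Mathlib
import Summits.ValiantsHypothesis.ValiantsHypothesis.Theorems.NewtonUnitEquationsNewtonTauWeakK3Defs

/-!
# `NewtonTauWeak` (stmt-ValiantsHypothesis-5904), line `binomial-normal-form`, `K = 3` rung: LINES
# (grouping the exponent directions by lines through the origin)

Third file of the `K = 3` global count (sub-stub `fixedKCoincidence_t2_K3`; plan
`Cruxes/NewtonTauWeak/Lines/binomial-normal-form-ltc.md` §2).  After the flip every binomial is `1 − ρ X^{δ_j}` with
`δ_j ∈ ℤ² ∖ 0` of positive weight; grouping the `δ_j` by the LINE `ℚ δ_j` and writing `δ_j = k_j ε_e` over the primitive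
generator `ε_e` of its line turns a product of binomials into a SEPARATED PRODUCT `Π_e Q_e(X^{ε_e})` with univariate
`Q_e(s) = Π_{j on e} (1 − ρ_j s^{k_j})` (`exists_lines`, `linePoly*`).  Also here: the NO-SHORT-RELATIONS hypothesis of the
stub in `ℤ²`-form and its consequence for the line data — a two-letter point `k₁ε_{e₁} + k₂ε_{e₂}` within multiplicity range
is on no ray (`not_onRay_pair`).  No definitions (the line data are an existential package). [folklore]
-/

-- the namespace mandated for this Theorems file repeats the component `ValiantsHypothesis`
set_option linter.dupNamespace false

noncomputable section

open scoped BigOperators Polynomial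
open Summit.ValiantsHypothesis.ValiantsHypothesis.Theorems.NewtonTauWeakCorner
  (wt wt_add wt_zsmul wt_push push sepCoeff box OnRay)

namespace Summit.ValiantsHypothesis.ValiantsHypothesis.Theorems.NewtonTauWeakK3k5

open Summit.ValiantsHypothesis.ValiantsHypothesis.Theorems.NewtonTauWeakK3

/-! ## Primitive vectors -/

/-- Two parallel lattice vectors, the first primitive (Bezout), differ by an integer factor. [folklore] -/
theorem exists_eq_smul_of_parallel {p q : Fin 2 → ℤ} (hp : Int.gcd (p 0) (p 1) = 1)
    (hpar : p 0 * q 1 = p 1 * q 0) : ∃ k : ℤ, q = k • p := by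
  refine ⟨Int.gcdA (p 0) (p 1) * q 0 + Int.gcdB (p 0) (p 1) * q 1, ?_⟩
  have hb := Int.gcd_eq_gcd_ab (p 0) (p 1)
  rw [hp] at hb
  push_cast at hb
  funext i
  fin_cases i
  · show q 0 = (Int.gcdA (p 0) (p 1) * q 0 + Int.gcdB (p 0) (p 1) * q 1) * p 0
    linear_combination q 0 * hb - Int.gcdB (p 0) (p 1) * hpar
  · show q 1 = (Int.gcdA (p 0) (p 1) * q 0 + Int.gcdB (p 0) (p 1) * q 1) * p 1
    linear_combination q 1 * hb + Int.gcdA (p 0) (p 1) * hpar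

/-- Two parallel PRIMITIVE lattice vectors are equal or opposite. [folklore] -/
theorem eq_or_eq_neg_of_parallel {p q : Fin 2 → ℤ} (hp : Int.gcd (p 0) (p 1) = 1) (hq : Int.gcd (q 0) (q 1) = 1)
    (hpar : p 0 * q 1 = p 1 * q 0) : q = p ∨ q = -p := by
  obtain ⟨k, hk⟩ := exists_eq_smul_of_parallel hp hpar
  obtain ⟨k', hk'⟩ := exists_eq_smul_of_parallel hq (by linarith)
  have hp0 : p ≠ 0 := by
    rintro rfl
    simp at hp
  have hkk : k' * k = 1 := by
    have h1 : p = (k' * k) • p := by rw [mul_smul, ← hk, ← hk']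
    have h2 : (1 - k' * k) • p = 0 := by rw [sub_smul, one_smul, ← h1, sub_self]
    rcases smul_eq_zero.mp h2 with h | h
    · linarith
    · exact absurd h hp0
  rcases Int.eq_one_or_neg_one_of_mul_eq_one' hkk |>.imp And.right And.right with rfl | rfl
  · left; rw [hk, one_smul]
  · right; rw [hk, neg_smul, one_smul]

/-! ## The line data of a list of nonzero directions -/

/-- **Lines.**  Nonzero lattice vectors `δ_j ∈ ℤ²` group into `s ≤ N` lines: primitive generators `ε_e`, a line map and
positive multiplicities with `δ_j = k_j ε_{line j}`; every line is used; a weight positive on all `δ_j` is positive on all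
`ε_e`; and no positive multiple of one generator is a positive multiple of another (the hypothesis `hE` of the corner
model). [folklore] -/
theorem exists_lines {ι : Type*} [Fintype ι] [DecidableEq ι] (δ : ι → Fin 2 → ℤ) (hδ : ∀ j, δ j ≠ 0) :
    ∃ (s : ℕ) (ε : Fin s → Fin 2 → ℤ) (line : ι → Fin s) (mult : ι → ℕ),
      s ≤ Fintype.card ι ∧ Function.Surjective line ∧ (∀ j, 1 ≤ mult j) ∧ (∀ j, δ j = (mult j : ℤ) • ε (line j)) ∧
      (∀ e, Int.gcd (ε e 0) (ε e 1) = 1) ∧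
      (∀ ω : Fin 2 → ℝ, (∀ j, 0 < wt ω (δ j)) → ∀ e, 0 < wt ω (ε e)) ∧
      (∀ ω : Fin 2 → ℝ, (∀ e, 0 < wt ω (ε e)) →
        ∀ e e' : Fin s, ∀ k k' : ℕ, 1 ≤ k → (k : ℤ) • ε e = (k' : ℤ) • ε e' → e = e') := by
  classical
  -- primitive parts
  have hg : ∀ j, 0 < Int.gcd (δ j 0) (δ j 1) := by
    intro j
    rw [Int.gcd_pos_iff]
    by_contra h
    push Not at h
    exact hδ j (funext fun i => by fin_cases i <;> simp [h.1, h.2])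
  choose g m n hg0 hmn hm hn using fun j => Int.exists_gcd_one' (hg j)
  set prim : ι → Fin 2 → ℤ := fun j => ![m j, n j] with hprim
  have hprim0 : ∀ j, prim j 0 = m j := fun j => rfl
  have hprim1 : ∀ j, prim j 1 = n j := fun j => rfl
  have hdecomp : ∀ j, δ j = ((g j : ℕ) : ℤ) • prim j := by
    intro j; funext i; fin_cases i
    · show δ j 0 = (g j : ℤ) * prim j 0
      rw [hprim0, hm j, mul_comm]
    · show δ j 1 = (g j : ℤ) * prim j 1
      rw [hprim1, hn j, mul_comm]
  -- enumerate the distinct primitive parts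
  set S : Finset (Fin 2 → ℤ) := Finset.univ.image prim with hS
  have hmem : ∀ j, prim j ∈ S := fun j => Finset.mem_image_of_mem _ (Finset.mem_univ j)
  set eqv := S.equivFin with heqv
  refine ⟨S.card, fun e => (eqv.symm e).1, fun j => eqv ⟨prim j, hmem j⟩, g,
    Finset.card_image_le.trans (Finset.card_univ (α := ι)).le, ?_, hg0, ?_, ?_, ?_, ?_⟩
  · -- every line is used
    intro e
    obtain ⟨j, -, hj⟩ := Finset.mem_image.mp (eqv.symm e).2
    refine ⟨j, ?_⟩
    apply eqv.symm.injective
    rw [Equiv.symm_apply_apply]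
    exact Subtype.ext hj
  · intro j
    dsimp only
    rw [Equiv.symm_apply_apply]
    exact hdecomp j
  · intro e
    dsimp only
    obtain ⟨j, -, hj⟩ := Finset.mem_image.mp (eqv.symm e).2
    rw [← hj, hprim0, hprim1]
    exact hmn j
  · intro ω hω e
    dsimp only
    obtain ⟨j, -, hj⟩ := Finset.mem_image.mp (eqv.symm e).2
    rw [← hj]
    have h := hω j
    rw [hdecomp j, wt_zsmul] at h
    push_cast at h
    have hgpos : (0 : ℝ) < (g j : ℝ) := by exact_mod_cast hg0 j
    exact pos_of_mul_pos_right h hgpos.le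
  · intro ω hω e e' k k' hk hkk
    dsimp only at hkk
    obtain ⟨j, -, hj⟩ := Finset.mem_image.mp (eqv.symm e).2
    obtain ⟨j', -, hj'⟩ := Finset.mem_image.mp (eqv.symm e').2
    -- both generators have positive weight; they are parallel primitive vectors
    have h1 : 0 < wt ω (prim j) := by rw [hj]; exact hω e
    have h2 : 0 < wt ω (prim j') := by rw [hj']; exact hω e'
    rw [← hj, ← hj'] at hkk
    have hpar : prim j 0 * prim j' 1 = prim j 1 * prim j' 0 := by
      have h0 := congr_fun hkk 0
      have h1 := congr_fun hkk 1
      simp only [Pi.smul_apply, smul_eq_mul] at h0 h1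
      have hk0 : (k : ℤ) ≠ 0 := by exact_mod_cast (by omega : k ≠ 0)
      have : (k : ℤ) * (prim j 0 * prim j' 1 - prim j 1 * prim j' 0) = 0 := by
        linear_combination prim j' 1 * h0 - prim j' 0 * h1
      rcases mul_eq_zero.mp this with h | h
      · exact absurd h hk0
      · linarith
    have hpj : Int.gcd (prim j 0) (prim j 1) = 1 := by rw [hprim0, hprim1]; exact hmn j
    have hpj' : Int.gcd (prim j' 0) (prim j' 1) = 1 := by rw [hprim0, hprim1]; exact hmn j'
    rcases eq_or_eq_neg_of_parallel hpj hpj' hpar with h | h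
    · apply eqv.symm.injective
      exact Subtype.ext (by rw [← hj, ← hj', h])
    · exfalso
      -- opposite vectors cannot both have positive weight
      rw [h] at h2
      have : wt ω (-prim j) = -wt ω (prim j) := by simp [wt]; ring
      linarith

/-! ## Products of binomials along lines -/

/-- The univariate LINE POLYNOMIAL of a family of binomials on one line has constant term `1`:
`[s^0] Π_{j ∈ J} (1 − ρ_j s^{k_j}) = 1` for positive `k_j`. [folklore] -/
theorem linePoly_coeff_zero {ι : Type*} (J : Finset ι) (ρ : ι → ℂ) (k : ι → ℕ) (hk : ∀ j, 1 ≤ k j) :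
    (∏ j ∈ J, (1 - Polynomial.C (ρ j) * Polynomial.X ^ k j)).coeff 0 = 1 := by
  rw [Polynomial.coeff_zero_prod]
  refine Finset.prod_eq_one fun j _ => ?_
  rw [Polynomial.coeff_sub, Polynomial.coeff_one_zero, Polynomial.coeff_C_mul, Polynomial.coeff_X_pow,
    if_neg (by have := hk j; omega)]
  ring

/-- Degree bound for a line polynomial: `deg Π_{j ∈ J} (1 − ρ_j s^{k_j}) ≤ Σ_{j ∈ J} k_j`. [folklore] -/
theorem linePoly_natDegree_le {ι : Type*} (J : Finset ι) (ρ : ι → ℂ) (k : ι → ℕ) :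
    (∏ j ∈ J, (1 - Polynomial.C (ρ j) * Polynomial.X ^ k j)).natDegree ≤ ∑ j ∈ J, k j := by
  refine (Polynomial.natDegree_prod_le _ _).trans (Finset.sum_le_sum fun j _ => ?_)
  refine (Polynomial.natDegree_sub_le _ _).trans (max_le (by simp) ?_)
  exact (Polynomial.natDegree_C_mul_le _ _).trans (Polynomial.natDegree_X_pow_le _)

/-- Substituting a line polynomial along its generator gives back the product of the binomials:
`(Π_{j ∈ J} (1 − ρ_j s^{k_j}))(X^{ε}) = Π_{j ∈ J} (1 − ρ_j X^{k_j ε})`. [folklore] -/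
theorem aeval_T_linePoly {ι : Type*} (J : Finset ι) (ρ : ι → ℂ) (k : ι → ℕ) (ε : Fin 2 → ℤ) :
    Polynomial.aeval (T ε) (∏ j ∈ J, (1 - Polynomial.C (ρ j) * Polynomial.X ^ k j)) =
      ∏ j ∈ J, (1 - ρ j • T ((k j : ℤ) • ε)) := by
  rw [map_prod]
  refine Finset.prod_congr rfl fun j _ => ?_
  rw [map_sub, map_one, map_mul, Polynomial.aeval_C, map_pow, Polynomial.aeval_X, T_pow, ← Algebra.smul_def]

/-- A product of binomials over all indices is the separated product of the line polynomials along the lines.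
[folklore] -/
theorem prod_binomial_eq_prod_lines {ι : Type*} [Fintype ι] {s : ℕ} (ε : Fin s → Fin 2 → ℤ) (line : ι → Fin s)
    (mult : ι → ℕ) (δ : ι → Fin 2 → ℤ) (hδ : ∀ j, δ j = (mult j : ℤ) • ε (line j)) (ρ : ι → ℂ) :
    ∏ j, (1 - ρ j • T (δ j)) =
      ∏ e, Polynomial.aeval (T (ε e))
        (∏ j ∈ Finset.univ.filter (fun j => line j = e), (1 - Polynomial.C (ρ j) * Polynomial.X ^ mult j)) := by
  classical
  simp_rw [aeval_T_linePoly]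
  rw [← Finset.prod_fiberwise_of_maps_to (g := line) (t := Finset.univ) (fun j _ => Finset.mem_univ (line j))]
  refine Finset.prod_congr rfl fun e _ => Finset.prod_congr rfl fun j hj => ?_
  rw [hδ j, (Finset.mem_filter.mp hj).2]

/-! ## No short relations: two-letter points are off-ray -/

/-- Parallel generators of positive weight coincide (a positive multiple of one is a positive multiple of the other).
[folklore] -/
theorem eq_of_parallel {s : ℕ} (ε : Fin s → Fin 2 → ℤ) (ω : Fin 2 → ℝ) (hpos : ∀ e, 0 < wt ω (ε e))
    (hE : ∀ e e' : Fin s, ∀ k k' : ℕ, 1 ≤ k → (k : ℤ) • ε e = (k' : ℤ) • ε e' → e = e')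
    {e e' : Fin s} (hpar : ε e 0 * ε e' 1 = ε e 1 * ε e' 0) : e = e' := by
  -- integers `a, b`, not both zero, with `a ε_e = b ε_{e'}`
  obtain ⟨a, b, hab, heq⟩ : ∃ a b : ℤ, (a ≠ 0 ∨ b ≠ 0) ∧ a • ε e = b • ε e' := by
    by_cases h0 : ε e 0 = 0
    · have h1 : ε e 1 ≠ 0 := by
        intro h1
        have := hpos e
        simp [wt, h0, h1] at this
      refine ⟨ε e' 1, ε e 1, Or.inr h1, funext fun i => ?_⟩
      fin_cases i
      · show ε e' 1 * ε e 0 = ε e 1 * ε e' 0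
        linarith
      · show ε e' 1 * ε e 1 = ε e 1 * ε e' 1
        ring
    · refine ⟨ε e' 0, ε e 0, Or.inr h0, funext fun i => ?_⟩
      fin_cases i
      · show ε e' 0 * ε e 0 = ε e 0 * ε e' 0
        ring
      · show ε e' 0 * ε e 1 = ε e 0 * ε e' 1
        linarith
  have hw : (a : ℝ) * wt ω (ε e) = (b : ℝ) * wt ω (ε e') := by
    rw [← wt_zsmul, ← wt_zsmul, heq]
  have h1 := hpos e
  have h2 := hpos e'
  -- `a` and `b` are both nonzero and of the same sign
  have ha0 : a ≠ 0 := by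
    rintro rfl
    rcases hab with h | h
    · exact h rfl
    · have : (b : ℝ) * wt ω (ε e') = 0 := by rw [← hw]; simp
      rcases mul_eq_zero.mp this with h' | h'
      · exact h (by exact_mod_cast h')
      · linarith
  rcases lt_or_gt_of_ne ha0 with ha | ha
  · -- both negative: negate
    have hb : b < 0 := by
      by_contra hb
      push Not at hb
      have : (a : ℝ) * wt ω (ε e) < 0 := mul_neg_of_neg_of_pos (by exact_mod_cast ha) h1
      have : (0 : ℝ) ≤ (b : ℝ) * wt ω (ε e') := mul_nonneg (by exact_mod_cast hb) h2.le
      linarith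
    refine hE e e' a.natAbs b.natAbs (by omega) ?_
    have hA : ((a.natAbs : ℕ) : ℤ) = -a := by omega
    have hB : ((b.natAbs : ℕ) : ℤ) = -b := by omega
    rw [hA, hB, neg_smul, neg_smul, heq]
  · have hb : 0 < b := by
      by_contra hb
      push Not at hb
      have : (0 : ℝ) < (a : ℝ) * wt ω (ε e) := mul_pos (by exact_mod_cast ha) h1
      have : (b : ℝ) * wt ω (ε e') ≤ 0 := mul_nonpos_of_nonpos_of_nonneg (by exact_mod_cast hb) h2.le
      linarith
    refine hE e e' a.natAbs b.natAbs (by omega) ?_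
    have hA : ((a.natAbs : ℕ) : ℤ) = a := by omega
    have hB : ((b.natAbs : ℕ) : ℤ) = b := by omega
    rw [hA, hB, heq]

/-- **No short 2-vs-1 relations ⇒ two-letter points within multiplicity range are on no ray.**  In the line data of
`exists_lines`, if `e₁ ≠ e₂` and `1 ≤ k_i ≤ M_{e_i}` (`M_e = Σ_{line j = e} mult_j`, the total multiplicity of the line),
then `k₁ε_{e₁} + k₂ε_{e₂}` is not a positive multiple of any generator.  The hypothesis is the stub's `H(d)` transported
to `ℤ²` (parallelism `z₀δ₁ = z₁δ₀`, ranges `|z_i| ≤ Σ_{δ_j ∥ δ_{j₁}} |δ_j i|`). [this line; elementary] -/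
theorem not_onRay_pair {ι : Type*} [Fintype ι] [DecidableEq ι] {s : ℕ} (δ : ι → Fin 2 → ℤ) (ε : Fin s → Fin 2 → ℤ)
    (line : ι → Fin s) (mult : ι → ℕ) (ω : Fin 2 → ℝ)
    (hsurj : Function.Surjective line) (hδ : ∀ j, δ j = (mult j : ℤ) • ε (line j)) (hmult : ∀ j, 1 ≤ mult j)
    (hpos : ∀ e, 0 < wt ω (ε e))
    (hE : ∀ e e' : Fin s, ∀ k k' : ℕ, 1 ≤ k → (k : ℤ) • ε e = (k' : ℤ) • ε e' → e = e')
    (H : ∀ (j₁ j₂ j₃ : ι) (z₁ z₂ : Fin 2 → ℤ),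
      δ j₁ 0 * δ j₂ 1 ≠ δ j₁ 1 * δ j₂ 0 →
      z₁ ≠ 0 → z₁ 0 * δ j₁ 1 = z₁ 1 * δ j₁ 0 →
      (∀ i, |z₁ i| ≤ ∑ j, if δ j 0 * δ j₁ 1 = δ j 1 * δ j₁ 0 then |δ j i| else 0) →
      z₂ ≠ 0 → z₂ 0 * δ j₂ 1 = z₂ 1 * δ j₂ 0 →
      (∀ i, |z₂ i| ≤ ∑ j, if δ j 0 * δ j₂ 1 = δ j 1 * δ j₂ 0 then |δ j i| else 0) →
      (z₁ 0 + z₂ 0) * δ j₃ 1 ≠ (z₁ 1 + z₂ 1) * δ j₃ 0)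
    {e₁ e₂ : Fin s} (hne : e₁ ≠ e₂) {k₁ k₂ : ℕ} (hk₁ : 1 ≤ k₁) (hk₂ : 1 ≤ k₂)
    (hk₁M : k₁ ≤ ∑ j ∈ Finset.univ.filter (fun j => line j = e₁), mult j)
    (hk₂M : k₂ ≤ ∑ j ∈ Finset.univ.filter (fun j => line j = e₂), mult j) :
    ¬ OnRay ε ((k₁ : ℤ) • ε e₁ + (k₂ : ℤ) • ε e₂) := by
  classical
  rintro ⟨e₃, k₃, -, heq⟩
  obtain ⟨j₁, hj₁⟩ := hsurj e₁
  obtain ⟨j₂, hj₂⟩ := hsurj e₂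
  obtain ⟨j₃, hj₃⟩ := hsurj e₃
  have hε0 : ∀ e, ε e ≠ 0 := fun e h0 => by have := hpos e; rw [h0] at this; simp [wt] at this
  -- generators of distinct lines are not parallel
  have hnpar : δ j₁ 0 * δ j₂ 1 ≠ δ j₁ 1 * δ j₂ 0 := by
    intro hpar
    rw [hδ j₁, hδ j₂, hj₁, hj₂] at hpar
    simp only [Pi.smul_apply, smul_eq_mul] at hpar
    have hm1 : (mult j₁ : ℤ) ≠ 0 := by have := hmult j₁; omega
    have hm2 : (mult j₂ : ℤ) ≠ 0 := by have := hmult j₂; omega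
    have hpar' : ε e₁ 0 * ε e₂ 1 = ε e₁ 1 * ε e₂ 0 := by
      have : (mult j₁ : ℤ) * (mult j₂ : ℤ) * (ε e₁ 0 * ε e₂ 1 - ε e₁ 1 * ε e₂ 0) = 0 := by linear_combination hpar
      rcases mul_eq_zero.mp this with h | h
      · exact absurd h (mul_ne_zero hm1 hm2)
      · linarith
    exact hne (eq_of_parallel ε ω hpos hE hpar')
  -- the range bound along one line
  have hrange : ∀ (e : Fin s) (j₀ : ι), line j₀ = e → ∀ (k : ℕ), k ≤ ∑ j ∈ Finset.univ.filter (fun j => line j = e), mult j →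
      ∀ i, |((k : ℤ) • ε e) i| ≤ ∑ j, if δ j 0 * δ j₀ 1 = δ j 1 * δ j₀ 0 then |δ j i| else 0 := by
    intro e j₀ hj₀ k hk i
    rw [← Finset.sum_filter]
    have hsub : Finset.univ.filter (fun j => line j = e) ⊆
        Finset.univ.filter (fun j => δ j 0 * δ j₀ 1 = δ j 1 * δ j₀ 0) := by
      intro j hj
      have hj' := (Finset.mem_filter.mp hj).2
      refine Finset.mem_filter.mpr ⟨Finset.mem_univ j, ?_⟩
      rw [hδ j, hδ j₀, hj', hj₀]
      simp only [Pi.smul_apply, smul_eq_mul]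
      ring
    calc |((k : ℤ) • ε e) i| = (k : ℤ) * |ε e i| := by
            rw [Pi.smul_apply, smul_eq_mul, abs_mul, abs_of_nonneg (by positivity : (0 : ℤ) ≤ k)]
      _ ≤ (∑ j ∈ Finset.univ.filter (fun j => line j = e), (mult j : ℤ)) * |ε e i| := by
            apply mul_le_mul_of_nonneg_right _ (abs_nonneg _)
            exact_mod_cast hk
      _ = ∑ j ∈ Finset.univ.filter (fun j => line j = e), |δ j i| := by
            rw [Finset.sum_mul]
            refine Finset.sum_congr rfl fun j hj => ?_
            rw [hδ j, (Finset.mem_filter.mp hj).2, Pi.smul_apply, smul_eq_mul, abs_mul,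
              abs_of_nonneg (by positivity : (0 : ℤ) ≤ mult j)]
      _ ≤ ∑ j ∈ Finset.univ.filter (fun j => δ j 0 * δ j₀ 1 = δ j 1 * δ j₀ 0), |δ j i| :=
            Finset.sum_le_sum_of_subset_of_nonneg hsub fun j _ _ => abs_nonneg _
  have hz₁ : ((k₁ : ℤ) • ε e₁) ≠ 0 := smul_ne_zero (by exact_mod_cast (by omega : k₁ ≠ 0)) (hε0 e₁)
  have hz₂ : ((k₂ : ℤ) • ε e₂) ≠ 0 := smul_ne_zero (by exact_mod_cast (by omega : k₂ ≠ 0)) (hε0 e₂)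
  have hpar₁ : ((k₁ : ℤ) • ε e₁) 0 * δ j₁ 1 = ((k₁ : ℤ) • ε e₁) 1 * δ j₁ 0 := by
    rw [hδ j₁, hj₁]; simp only [Pi.smul_apply, smul_eq_mul]; ring
  have hpar₂ : ((k₂ : ℤ) • ε e₂) 0 * δ j₂ 1 = ((k₂ : ℤ) • ε e₂) 1 * δ j₂ 0 := by
    rw [hδ j₂, hj₂]; simp only [Pi.smul_apply, smul_eq_mul]; ring
  refine H j₁ j₂ j₃ _ _ hnpar hz₁ hpar₁ (hrange e₁ j₁ hj₁ k₁ hk₁M) hz₂ hpar₂ (hrange e₂ j₂ hj₂ k₂ hk₂M) ?_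
  have h0 := congr_fun heq 0
  have h1 := congr_fun heq 1
  simp only [Pi.add_apply, Pi.smul_apply, smul_eq_mul] at h0 h1 ⊢
  rw [h0, h1, hδ j₃, hj₃]
  simp only [Pi.smul_apply, smul_eq_mul]
  ring

end Summit.ValiantsHypothesis.ValiantsHypothesis.Theorems.NewtonTauWeakK3k5

end
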